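import Literature.MathematicalPhysics.QuantumFieldTheory.Balaban1983to89.T4PersistenceRenewal

/-!
# `Balaban1983to89.T4MarginalRenewal` — the U5c weight slot in the MARGINAL (environment-summed) currency: slot odds,
marginal event domination, and a decided toy separating pointwise from averaged prices
(cell `pub-balaban`, T4-DAG §5 self-row T4-U5c.E-NE7b-PROVE-P2h* (§8 Q24(a)), node U5c / U5.E, spine estimate NE7b,
renewal member P2, gen 8; kernel bookkeeping, Mathlib + `T4PersistenceRenewal` only; census item v22 of
`t4/T4-EST-NE7b-P2.md`)

HONEST FRAMING (T4-DAG PAGE 1).  The cell's T4 target is the existence and uniqueness of the `ε → 0` limit of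
unit-scale block-averaged expectations on a FIXED finite torus, at rung (B)+1, CONDITIONAL on Bałaban's ultraviolet
stability (B) and on BetaPertH; it is NOT infinite volume, NOT the mass gap, NOT the Clay problem.  This module is
[folklore] finite summation and real arithmetic; NOTHING of Bałaban's is asserted — the shapes `SlotOdds` and
`MarginalEventDom` below are NAMED BINDERS, and the module says nothing about whether they hold for the (1.104) family
of [Balaban1989LargeFieldII].  NOT summit progress, NOT a proof of NE7b.  Value = a third TYPING of the currency in
which the kernel's weight slot can be discharged — AVERAGED over the environment where the lineage's wall G-ne7bp2-1
(`T4PersistenceRenewal.EventDom`) is uniform in it, and free of any global lower bound.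

THE POINT.  The kernel's slot is `T4WeightBudget.RelWeightBound l₀ T A B Bad W`: per run and per `(K, t)`, the class
`Bad K t` of terms carrying OLD PENDING large-field structure has RELATIVE weight `≤ W K`, `W` summable.  Every typed
currency through which the cell has so far proposed to discharge it is either POINTWISE IN THE CONTEXT —
`T4HistoryPeeling.SlotDom`, `T4PersistenceRenewal.FibreRate` / `EventDom`, `T4InsertionProfile.PointDom` bound the
insertion fibre over EACH frozen context `τ″` (slot `i` switched off) by that context's own weight, UNIFORMLY in `τ″`
(the (FR) typing; its unprinted heart is this context-uniformity — failure mode (F1) of row U5.E-a, whose locus is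
the decomposition (1.101) p. 390: what a deleted structure changes in its context) — or GLOBAL —
`T4GlobalDenominator.GlobalDom` bounds the bad terms ABSOLUTELY against a common lower envelope of the full sum (the
(GD) typing: (B) with BOTH halves, incl. a (2.50)-type lower bound in d = 4, GAPS G-adv3-2).  The renewal reading
of persistence (this lineage's technique) points at a third, intermediate currency, typed and wired here: a renewal
process is controlled by HAZARD RATES CONDITIONAL ON ITS OWN PAST — the rate of one more renewal given the slot's
record so far — with the environment SUMMED OUT, never frozen; and what the slot consumes at the end is only the ODDS
that slot `i` is still live at the cutoff, i.e. the ratio of TWO PARTITION FUNCTIONS of the same run, slot `i` live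
versus slot `i` switched off, everything else (the other slots, the environment, the healed past) summed on both sides.

 §1 the two-line algebra odds ⇔ relative weight (`rel_of_odds`, `odds_of_rel`).
 §2 `SlotOdds l₀ T A Bad S` — per `(K, t)`: finitely many slots with pending SUBSETS `P i ⊆ T K` covering `Bad K t`,
    activities `x ≥ 0`, `Σ_i x i ≤ S K`, and the AVERAGED single-slot clause `Σ_{P i} A ≤ x i · Σ_{T K ∖ P i} A`.
    Theorems: `sum_le_sum_slots` (union bound over slots with weights non-negative ON `T K` only — the tree's
    `T4WeightBudget.relWeight_le_sum_of_cover` wants them non-negative everywhere); `SlotOdds.bad_le`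
    (`Σ_{Bad} A ≤ S K · Σ_{T K} A`); `exists_relWeightBound_of_slotOdds` (both runs, `S ≥ 0` summable ⇒ `∃ K₀`,
    `RelWeightBound` in the `T4WeightBudget.relWeightBound_of_eventually` shape — `W K < 1` cannot be forced by a union
    bound, two complementary slots already give `Bad = T`); `T4HistoryPeeling.SlotDom.toSlotOdds` (the CONTEXT-WISE
    clause summed over contexts along `off i`: the whole (FR) chain `EventDom ⇒ FibreRate ⇒ SlotDom` lands here by
    name); and the converse `slotOdds_of_relWeightBound` (ONE slot `P := Bad`, `x := W/(1 − W)`).  So `SlotOdds` IS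
    the kernel's output clause localised to slots — the weakest per-slot currency there is: it tolerates arbitrary
    correlation between slots, needs NO switch-off MAP on terms (only the pending subsets), NO uniformity in the
    context, NO lower envelope; the union bound over slots is its only loss.
 §3 `MarginalEventDom l₀ T A Bad z η B₀ D V Λ j⋆` — per `(K, t)` and per slot `i`: a finite HISTORY-CLASS projection
    `hist i : ι → Fin (m i)` (a term ↦ the record of slot `i`'s own events), pending classes `PendC i`, and
    `T4PersistenceRenewal.ForestDom` on the class MARGINALS `c ↦ Σ_{τ ∈ T K, hist i τ = c} A K t τ` relative to the
    slot's OFF-mass `Σ_{τ ∈ T K, hist i τ ∉ PendC i} A K t τ`, horizon `K − j i`, with the old birth scales and the R4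
    count of `EventDom`; `MarginalEventDom.toSlotOdds` (`x i := (B₀D/η)(z⁻¹)^{K − j i}`, budget by
    `T4HistoryPeeling.slotBudget_le`) and `exists_relWeightBound_of_marginalEventDom`; `ForestDom.of_ref_le` /
    `forestDom_off_of_class` (a forest rooted against a SMALLER reference — e.g. the marginal of the empty-record class
    alone, the natural two-partition-function birth odds — is one against the typed OFF-mass).  RENEWAL READING of the forest clauses in this currency: `child` = the HAZARD of one more event at age
    `s` given the slot's own record `c′` (environment summed out: `Σ_{c : parent c = c′, last c = s} v c ≤
    F s (s − last c′) · v c′` between class marginals), `root` = the marginal BIRTH odds, `term` = the unrenormalised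
    factor still carried at the cutoff — conditional on the slot's own past only, which is how renewal theory states
    persistence ([Feller I] ch. XIII, context only).  Relation to `EventDom` (one forest PER FROZEN CONTEXT `τ″`,
    relative to `A τ″`): both shapes are sufficient for `SlotOdds` (`EventDom` via `FibreRate ⇒ SlotDom ⇒ SlotOdds`,
    proved; `MarginalEventDom.toSlotOdds`); the marginal clauses are what `EventDom`'s clauses become when summed over
    the contexts with a COMMON kernel and profiles — as typed, `EventDom`'s witnesses are existential per context, so no
    implication between the two shapes is claimed or proved here; what the marginal shape asks of the expansion is an
    environment-AVERAGED bound where `EventDom` asks a uniform one.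
 §4 a decided toy (`ι = Bool × ℕ`; contexts `c ≤ K` of mass `4^{−c}`, each with or without ONE pending structure of
    weight `σ^K · 2^{−c}`, `σ = 3/4`): the natural deletion `(true, c) ↦ (false, c)` has price `σ^K · 2^c` at context
    `c`, so ANY context-free price valid at step `K` is `≥ (3/2)^K` (`toy_pointwise_ge`) and no `K`-uniform one exists
    (`toy_no_uniform_price`), while the slot odds are `≤ 2σ^K`, summable (`toy_slotOdds`, `toy_relWeightBound`).  The
    toy separates the natural deletion DICTIONARY read pointwise from the same dictionary read on average; it does not
    separate the abstract shapes (`SlotDom` is still inhabited there by the degenerate switch-off map sending every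
    pending term to the heaviest context — checked by hand, not formalised; cf. `SlotDom.toSlotOdds`).

WHAT IS PRINTED TOWARD THE MARGINAL CLAUSES, AND WHAT IS NOT (LOCATION only; nothing below is an input of this module).
[Balaban1989LargeFieldII] prints, per renormalisation operation, SUP-bounds: the small factor per large-field region
(1.79) p. 383 with the record entropy «exp O(1)(MR_j)^{−d}|Z_j|» p. 383 (feeding `root`/`F` through
`T4PersistenceRenewal` §7–§8), the renewal rule «K = R_{j+1}» p. 386 and (1.88)–(1.89) p. 387 (feeding `child`), and
the decomposition (1.101) p. 390 of what an ℝ-operation leaves in the action (small-field action, R′^{(k)}, boundary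
terms B′^{(k)}).  The marginal `root`/`child` clauses are RATIOS OF PARTITION FUNCTIONS differing in one slot's record,
environment summed: they consume the environment-AVERAGED effect of the terms of (1.101) near the structure, weighted by
the environment's own mass — not its supremum over frozen environments, which is what (FR)/(EN) consume.  Neither form
is printed as a statement; the cell's wall G-ne7bp2-1 (`EventDom`, context-uniform) hereby acquires an
environment-AVERAGED ALTERNATIVE typing (`MarginalEventDom`) — NOT a discharge of either — and nothing of (B)'s lower
half is used or needed in this currency.  BetaPertH / (B) / (B^μ) are untouched
and hidden nowhere; every conditional of the consumer stays the consumer's binder.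

References (locators only): [Balaban1989LargeFieldII] = T. Bałaban, Large field renormalization. II, Comm. Math. Phys.
122 (1989) 355–392 — (1.79) p. 383, p. 386, (1.88)–(1.89) p. 387, (1.101) p. 390, (1.104) p. 391 (held text
`paper:balaban1989-cmp122-large-field-ii`); [Feller I] = W. Feller, An Introduction to Probability Theory and its
Applications I, ch. XIII (recurrent events) — vocabulary only, as in `T4PersistenceRenewal`'s header.
-/

open Finset _root_.Filter _root_.Topology

namespace Literature.MathematicalPhysics.QuantumFieldTheory.Balaban1983to89.T4MarginalRenewal

open Literature.MathematicalPhysics.QuantumFieldTheory.Balaban1983to89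
open T4WeightBudget T4HistoryPeeling T4PersistenceRenewal

/-! ## §1 Odds versus relative weight -/

section OddsAlgebra

/-- ODDS ⇒ RELATIVE: `P ≤ x·N` with `0 ≤ x` gives `P ≤ (x/(1+x))·(P + N)`. [folklore] -/
theorem rel_of_odds {P N x : ℝ} (hx : 0 ≤ x) (h : P ≤ x * N) : P ≤ x / (1 + x) * (P + N) := by
  have h1 : 0 < 1 + x := by linarith
  rw [div_mul_eq_mul_div, le_div_iff₀ h1]
  nlinarith [h, hx]

/-- RELATIVE ⇒ ODDS: `P ≤ w·(P + N)` with `w < 1` gives `P ≤ (w/(1−w))·N`. [folklore] -/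
theorem odds_of_rel {P N w : ℝ} (hw : w < 1) (h : P ≤ w * (P + N)) : P ≤ w / (1 - w) * N := by
  have h1 : 0 < 1 - w := by linarith
  rw [div_mul_eq_mul_div, le_div_iff₀ h1]
  nlinarith [h, hw]

/-- The relative weight of given odds does not exceed the odds: `x/(1+x) ≤ x` for `x ≥ 0`. [folklore] -/
theorem rel_le_odds {x : ℝ} (hx : 0 ≤ x) : x / (1 + x) ≤ x := div_le_self hx (by linarith)

end OddsAlgebra

/-! ## §2 The averaged single-slot currency `SlotOdds` and its liaison to `RelWeightBound` -/

section Slots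

variable {ι : Type*}

/-- **UNION BOUND OVER SLOTS**: a class covered by the pending subsets weighs at most the sum of their weights, for
weights non-negative ON `T` (sub-classes of `T`). [folklore] -/
theorem sum_le_sum_slots {n : ℕ} {T Bad : Finset ι} (P : Fin n → Finset ι) {a : ι → ℝ}
    (ha : ∀ τ ∈ T, 0 ≤ a τ) (hsub : Bad ⊆ T) (hP : ∀ i, P i ⊆ T) (hcov : ∀ τ ∈ Bad, ∃ i, τ ∈ P i) :
    ∑ τ ∈ Bad, a τ ≤ ∑ i, ∑ τ ∈ P i, a τ := by
  classical
  calc ∑ τ ∈ Bad, a τ ≤ ∑ τ ∈ Bad, ∑ i, (if τ ∈ P i then a τ else 0) := by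
        refine Finset.sum_le_sum fun τ hτ => ?_
        obtain ⟨i, hi⟩ := hcov τ hτ
        calc a τ = (if τ ∈ P i then a τ else 0) := by rw [if_pos hi]
          _ ≤ ∑ i', (if τ ∈ P i' then a τ else 0) :=
            Finset.single_le_sum (f := fun i' => if τ ∈ P i' then a τ else 0)
              (fun i' _ => by
                show 0 ≤ (if τ ∈ P i' then a τ else 0)
                split_ifs
                · exact ha τ (hsub hτ)
                · exact le_rfl) (Finset.mem_univ i)
    _ ≤ ∑ τ ∈ T, ∑ i, (if τ ∈ P i then a τ else 0) :=
        Finset.sum_le_sum_of_subset_of_nonneg hsub fun τ hτ _ =>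
          Finset.sum_nonneg fun i _ => by
            show 0 ≤ (if τ ∈ P i then a τ else 0)
            split_ifs
            · exact ha τ hτ
            · exact le_rfl
    _ = ∑ i, ∑ τ ∈ T, (if τ ∈ P i then a τ else 0) := Finset.sum_comm
    _ = ∑ i, ∑ τ ∈ P i, a τ := Finset.sum_congr rfl fun i _ => by
        rw [← Finset.sum_filter, Finset.filter_mem_eq_inter, Finset.inter_eq_right.2 (hP i)]

variable [DecidableEq ι]

/-- **SLOT ODDS (HYPOTHESIS SHAPE; NOT PRINTED, NOT ASSERTED — the U5c slot localised to slots and AVERAGED over the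
context).**  At each `(K, t)`, `|t| ≤ l₀`: finitely many slots `Fin n` with PENDING SUBSETS `P i ⊆ T K` (the terms in
which slot `i` carries a structure still pending at step `K`) covering the bad class, activities `x ≥ 0` with
`Σ_i x i ≤ S K`, and the AVERAGED SINGLE-SLOT CLAUSE `Σ_{τ ∈ P i} A K t τ ≤ x i · Σ_{τ ∈ T K ∖ P i} A K t τ` — the
odds of slot `i` being live: two partition functions of the same run, everything but slot `i`'s status summed.
DICTIONARY (the cell's reading of [Balaban1989LargeFieldII] (1.104) p. 391, NOT a quotation): terms = large-field
histories of ONE run after `K` steps with their non-negative weights at real `t`; slot `i` = (birth scale `j < j⋆(K)`,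
anchor cell); `P i` = histories with a component pending at `K` whose first region is anchored at slot `i`.  Compared
with `T4HistoryPeeling.SlotDom`: no switch-off MAP, no clause per frozen context, arbitrary correlation between slots
allowed (`SlotDom.toSlotOdds`; converse `slotOdds_of_relWeightBound`). [folklore] -/
structure SlotOdds (l₀ : ℝ) (T : ℕ → Finset ι) (A : ℕ → ℝ → ι → ℝ) (Bad : ℕ → ℝ → Finset ι) (S : ℕ → ℝ) :
    Prop where
  /-- per `(K, t)`: slots, pending subsets, activities, budget, cover, averaged single-slot clause -/
  dom : ∀ K t, |t| ≤ l₀ → ∃ (n : ℕ) (P : Fin n → Finset ι) (x : Fin n → ℝ),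
    (∀ i, 0 ≤ x i) ∧ ∑ i, x i ≤ S K ∧ Bad K t ⊆ T K ∧ (∀ i, P i ⊆ T K) ∧ (∀ τ ∈ Bad K t, ∃ i, τ ∈ P i) ∧
    ∀ i : Fin n, ∑ τ ∈ P i, A K t τ ≤ x i * ∑ τ ∈ T K \ P i, A K t τ

/-- **PER SLOT, ODDS ⇒ RELATIVE WEIGHT against the slot's whole family**: `Σ_{P} a ≤ x·Σ_{T ∖ P} a`, `P ⊆ T`,
`0 ≤ x` ⇒ `Σ_{P} a ≤ (x/(1+x))·Σ_{T} a`. [folklore] -/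
theorem slot_rel_of_odds {T P : Finset ι} {a : ι → ℝ} {x : ℝ} (hx : 0 ≤ x) (hP : P ⊆ T)
    (h : ∑ τ ∈ P, a τ ≤ x * ∑ τ ∈ T \ P, a τ) : ∑ τ ∈ P, a τ ≤ x / (1 + x) * ∑ τ ∈ T, a τ := by
  rw [← Finset.sum_sdiff hP, add_comm (∑ τ ∈ T \ P, a τ) (∑ τ ∈ P, a τ)]
  exact rel_of_odds hx h

/-- **PER SLOT, RELATIVE WEIGHT ⇒ ODDS**: `Σ_{P} a ≤ w·Σ_{T} a`, `P ⊆ T`, `w < 1` ⇒ `Σ_{P} a ≤ (w/(1−w))·Σ_{T ∖ P} a`.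
[folklore] -/
theorem slot_odds_of_rel {T P : Finset ι} {a : ι → ℝ} {w : ℝ} (hw : w < 1) (hP : P ⊆ T)
    (h : ∑ τ ∈ P, a τ ≤ w * ∑ τ ∈ T, a τ) : ∑ τ ∈ P, a τ ≤ w / (1 - w) * ∑ τ ∈ T \ P, a τ := by
  rw [← Finset.sum_sdiff hP, add_comm (∑ τ ∈ T \ P, a τ) (∑ τ ∈ P, a τ)] at h
  exact odds_of_rel hw h

variable {l₀ : ℝ} {T : ℕ → Finset ι} {A B : ℕ → ℝ → ι → ℝ} {Bad : ℕ → ℝ → Finset ι} {S : ℕ → ℝ}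

/-- One run: `Σ_{Bad} A ≤ S K · Σ_{T} A` at every `(K, t)` (union bound over slots; per slot `x/(1+x) ≤ x`). [folklore] -/
theorem SlotOdds.bad_le (h : SlotOdds l₀ T A Bad S) (hA : ∀ K t, |t| ≤ l₀ → ∀ τ ∈ T K, 0 ≤ A K t τ) (K : ℕ)
    (t : ℝ) (ht : |t| ≤ l₀) : ∑ τ ∈ Bad K t, A K t τ ≤ S K * ∑ τ ∈ T K, A K t τ := by
  obtain ⟨n, P, x, hx, hxS, hsub, hP, hcov, hodds⟩ := h.dom K t ht
  have hT : 0 ≤ ∑ τ ∈ T K, A K t τ := Finset.sum_nonneg (hA K t ht)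
  calc ∑ τ ∈ Bad K t, A K t τ ≤ ∑ i, ∑ τ ∈ P i, A K t τ := sum_le_sum_slots P (hA K t ht) hsub hP hcov
    _ ≤ ∑ i, x i / (1 + x i) * ∑ τ ∈ T K, A K t τ :=
        Finset.sum_le_sum fun i _ => slot_rel_of_odds (hx i) (hP i) (hodds i)
    _ ≤ ∑ i, x i * ∑ τ ∈ T K, A K t τ :=
        Finset.sum_le_sum fun i _ => mul_le_mul_of_nonneg_right (rel_le_odds (hx i)) hT
    _ = (∑ i, x i) * ∑ τ ∈ T K, A K t τ := by rw [Finset.sum_mul]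
    _ ≤ S K * ∑ τ ∈ T K, A K t τ := mul_le_mul_of_nonneg_right hxS hT

/-- The bad class of a `SlotOdds` consists of terms. [folklore] -/
theorem SlotOdds.bad_subset (h : SlotOdds l₀ T A Bad S) (K : ℕ) (t : ℝ) (ht : |t| ≤ l₀) : Bad K t ⊆ T K := by
  obtain ⟨_, _, _, _, _, hsub, _⟩ := h.dom K t ht
  exact hsub

/-- **THE LIAISON (slot odds for both runs ⇒ NE7b's output shape, from some step on)**: `SlotOdds` for run A and run B
with a common budget `S ≥ 0`, `Σ_K S K < ∞`, non-negative weights ⇒ for some `K₀`, `T4WeightBudget.RelWeightBound` with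
the bad classes emptied below `K₀` and weights `S K` from `K₀` on (`relWeightBound_of_eventually`; `K₀` = any step
after which `S K < 1`).  A union bound cannot force `W K < 1` at every `K`, whence the `∃ K₀` form (precedent:
`T4GlobalDenominator.exists_relWeightBound_of_globalDom`). [folklore] -/
theorem exists_relWeightBound_of_slotOdds (hS0 : ∀ K, 0 ≤ S K) (hS : Summable S)
    (hA : ∀ K t, |t| ≤ l₀ → ∀ τ ∈ T K, 0 ≤ A K t τ) (hB : ∀ K t, |t| ≤ l₀ → ∀ τ ∈ T K, 0 ≤ B K t τ)
    (hOA : SlotOdds l₀ T A Bad S) (hOB : SlotOdds l₀ T B Bad S) :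
    ∃ K₀ : ℕ, RelWeightBound l₀ T A B (fun K t => if K₀ ≤ K then Bad K t else ∅)
      (Set.indicator {K | K₀ ≤ K} S) := by
  obtain ⟨K₀, hK₀⟩ := eventually_atTop.1 ((hS.tendsto_atTop_zero).eventually (gt_mem_nhds one_pos))
  exact ⟨K₀, relWeightBound_of_eventually (fun K t ht _ => hOA.bad_subset K t ht) (fun K _ => hS0 K)
    (fun K hK => hK₀ K hK) hS (fun K t ht _ => hOA.bad_le hA K t ht) (fun K t ht _ => hOB.bad_le hB K t ht)⟩

/-- **CONTEXT-WISE ⇒ AVERAGED**: `T4HistoryPeeling.SlotDom ⇒ SlotOdds` with the same budget — the single-slot clause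
over each frozen context `τ″`, summed over the contexts along `off i` (`Finset.sum_fiberwise_of_maps_to`; the switch-off
axioms `off_mem`, `pend_off_self` say exactly that `off i` maps the pending part of slot `i` into its switched-off part).
Hence the whole (FR) chain `EventDom ⇒ FibreRate ⇒ SlotDom` (`T4PersistenceRenewal`) lands in this currency by name.
[folklore] -/
theorem _root_.Literature.MathematicalPhysics.QuantumFieldTheory.Balaban1983to89.T4HistoryPeeling.SlotDom.toSlotOdds
    (h : SlotDom l₀ T A Bad S) : SlotOdds l₀ T A Bad S where
  dom K t ht := by
    obtain ⟨n, Φ, x, hx, hxS, hBad, h1⟩ := h.dom K t ht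
    refine ⟨n, fun i => (T K).filter fun τ => Φ.pend i τ = true, x, hx, hxS, ?_, fun i => Finset.filter_subset _ _,
      fun τ hτ => ?_, fun i => ?_⟩
    · rw [hBad]; exact Φ.bad_subset
    · rw [hBad] at hτ
      obtain ⟨i, hi⟩ := Φ.charge_nonempty_of_mem_bad hτ
      exact ⟨i, Finset.mem_filter.2 ⟨Φ.bad_subset hτ, Φ.mem_charge.1 hi⟩⟩
    · have hmaps : ∀ τ ∈ (T K).filter (fun τ => Φ.pend i τ = true),
          Φ.off i τ ∈ (T K).filter (fun τ => Φ.pend i τ = false) := fun τ hτ =>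
        Finset.mem_filter.2 ⟨Φ.off_mem i τ (Finset.mem_filter.1 hτ).1, Φ.pend_off_self i τ⟩
      have hoff : T K \ (T K).filter (fun τ => Φ.pend i τ = true) = (T K).filter (fun τ => Φ.pend i τ = false) := by
        rw [← Finset.filter_not]
        exact Finset.filter_congr fun τ _ => by simp
      rw [← Finset.sum_fiberwise_of_maps_to hmaps (A K t), hoff, Finset.mul_sum]
      refine Finset.sum_le_sum fun τ'' hτ'' => ?_
      rw [Finset.filter_filter]
      exact h1 i τ'' (Finset.mem_filter.1 hτ'').1 (Finset.mem_filter.1 hτ'').2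

/-- **THE CONVERSE: the output clause IS one-slot odds.**  A `RelWeightBound` (run A) gives `SlotOdds` for run A with
ONE slot `P := Bad K t` and activity `W K/(1 − W K)` — so `SlotOdds` is exactly the kernel's clause localised to slots,
the weakest per-slot currency. [folklore] -/
theorem slotOdds_of_relWeightBound {W : ℕ → ℝ} (h : RelWeightBound l₀ T A B Bad W) :
    SlotOdds l₀ T A Bad fun K => W K / (1 - W K) where
  dom K t ht := by
    have hW : 0 ≤ W K / (1 - W K) := div_nonneg (h.nonneg K) (by linarith [h.lt_one K])
    refine ⟨1, fun _ => Bad K t, fun _ => W K / (1 - W K), fun _ => hW, by simp, h.bad_subset K t ht,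
      fun _ => h.bad_subset K t ht, fun τ hτ => ⟨0, hτ⟩, fun _ => ?_⟩
    exact slot_odds_of_rel (h.lt_one K) (h.bad_subset K t ht) (h.bad_left K t ht)

end Slots

/-! ## §3 Marginal event domination: the renewal forest on the history classes of ONE slot, environment summed out -/

section Marginal

variable {ι : Type*}

/-- **REFERENCE MONOTONICITY of `ForestDom`**: a forest witness relative to a reference `a₀` is one relative to any
larger reference `a₀' ≥ a₀` (`B₀ ≥ 0`; only `root_budget` sees the reference).  Use: a marginal forest rooted against the
EMPTY-RECORD class alone (the natural two-partition-function birth odds) is a forest against the whole OFF-mass.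
[folklore] -/
theorem _root_.Literature.MathematicalPhysics.QuantumFieldTheory.Balaban1983to89.T4PersistenceRenewal.ForestDom.of_ref_le
    {γ : Type*} [DecidableEq γ] {Pend : Finset γ} {w : γ → ℝ} {a₀ a₀' : ℝ} {Ah : ℕ} {z η B₀ D : ℝ}
    (h : ForestDom Pend w a₀ Ah z η B₀ D) (hB₀ : 0 ≤ B₀) (ha : a₀ ≤ a₀') : ForestDom Pend w a₀' Ah z η B₀ D := by
  obtain ⟨X, hX⟩ := h.dom
  exact ⟨⟨⟨X.forest, X.v, X.F, X.b, X.term, X.pend_sub, X.last_le, X.v_nonneg, X.F_nonneg, X.gen,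
    fun s => (X.root_budget s).trans (mul_le_mul_of_nonneg_left ha hB₀), X.root, X.child, X.term_nonneg,
    X.weight_le⟩, hX⟩⟩

/-- **MARGINAL EVENT DOMINATION (HYPOTHESIS SHAPE; NOT PRINTED, NOT ASSERTED — the renewal currency of the U5c slot,
ONE LEVEL BELOW `SlotOdds`; the environment-AVERAGED counterpart of `T4PersistenceRenewal.EventDom`).**  Per `(K, t)`,
`|t| ≤ l₀`: slots `Fin n` with OLD birth scales `j i < j⋆(K)` and the R4 count `#{i : j i = j₀} ≤ V·Λ^{K − j₀}`; per
slot `i` a finite HISTORY-CLASS projection `hist i : ι → Fin (m i)` (a term ↦ the record of slot `i`'s own events: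
shapes, renewal and merger epochs, up to step `K`), the PENDING classes `PendC i` (records not yet healed at `K`),
the bad class covered by `{τ : hist i τ ∈ PendC i}`, and a `ForestDom` on the CLASS MARGINALS
`c ↦ Σ_{τ ∈ T K, hist i τ = c} A K t τ` relative to the OFF-mass `Σ_{τ ∈ T K, hist i τ ∉ PendC i} A K t τ`, horizon
`K − j i`, constants `(z, η, B₀, D)` uniform in `K`, `t`, `i`.  Its `child` clause reads: the marginal mass of the
records extending `c′` by one event at age `s` is `≤ F s (s − last c′)` times the marginal mass of `c′` — a HAZARD
bound conditional on the slot's own past, environment summed; NOT a bound per frozen environment. [folklore] -/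
structure MarginalEventDom (l₀ : ℝ) (T : ℕ → Finset ι) (A : ℕ → ℝ → ι → ℝ) (Bad : ℕ → ℝ → Finset ι)
    (z η B₀ D V Λ : ℝ) (jstar : ℕ → ℕ) : Prop where
  /-- per `(K, t)`: slots, class projections, pending classes, birth scales, cover, R4 count, marginal forests -/
  dom : ∀ K t, |t| ≤ l₀ → ∃ (n : ℕ) (m : Fin n → ℕ) (hist : ∀ i : Fin n, ι → Fin (m i))
    (PendC : ∀ i : Fin n, Finset (Fin (m i))) (j : Fin n → ℕ),
    Bad K t ⊆ T K ∧ (∀ τ ∈ Bad K t, ∃ i, hist i τ ∈ PendC i) ∧ (∀ i, j i < jstar K) ∧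
    (∀ j₀ < jstar K, (((Finset.univ : Finset (Fin n)).filter fun i => j i = j₀).card : ℝ) ≤ V * Λ ^ (K - j₀)) ∧
    ∀ i : Fin n, ForestDom (PendC i) (fun c => ∑ τ ∈ T K with hist i τ = c, A K t τ)
      (∑ τ ∈ T K with hist i τ ∉ PendC i, A K t τ) (K - j i) z η B₀ D

/-- The pending mass of a slot is the sum of its pending class marginals (fibrewise summation along `hist`). [folklore] -/
theorem sum_pending_eq_sum_marginals {m : ℕ} (T : Finset ι) (hist : ι → Fin m) (PendC : Finset (Fin m))
    (a : ι → ℝ) : ∑ τ ∈ T with hist τ ∈ PendC, a τ = ∑ c ∈ PendC, ∑ τ ∈ T with hist τ = c, a τ := by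
  have hmaps : ∀ τ ∈ T.filter (fun τ => hist τ ∈ PendC), hist τ ∈ PendC := fun τ hτ => (Finset.mem_filter.1 hτ).2
  rw [← Finset.sum_fiberwise_of_maps_to hmaps a]
  refine Finset.sum_congr rfl fun c hc => ?_
  rw [Finset.filter_filter]
  exact Finset.sum_congr (Finset.filter_congr fun τ _ => ⟨fun hτ => hτ.2, fun hτ => ⟨by rw [hτ]; exact hc, hτ⟩⟩)
    fun _ _ => rfl

/-- **ROOTING AGAINST ONE OFF-CLASS SUFFICES**: a marginal forest rooted against the marginal of ONE non-pending class
`c₀ ∉ PendC` (e.g. the empty record: no structure ever born at the slot — the natural two-partition-function birth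
odds) is a marginal forest against the whole OFF-mass, for weights non-negative on `T` (`ForestDom.of_ref_le`).
[folklore] -/
theorem forestDom_off_of_class {m : ℕ} {T : Finset ι} {hist : ι → Fin m} {PendC : Finset (Fin m)} {a : ι → ℝ}
    {c₀ : Fin m} {Ah : ℕ} {z η B₀ D : ℝ} (hc₀ : c₀ ∉ PendC) (ha : ∀ τ ∈ T, 0 ≤ a τ) (hB₀ : 0 ≤ B₀)
    (h : ForestDom PendC (fun c => ∑ τ ∈ T with hist τ = c, a τ) (∑ τ ∈ T with hist τ = c₀, a τ) Ah z η B₀ D) :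
    ForestDom PendC (fun c => ∑ τ ∈ T with hist τ = c, a τ) (∑ τ ∈ T with hist τ ∉ PendC, a τ) Ah z η B₀ D :=
  h.of_ref_le hB₀ (Finset.sum_le_sum_of_subset_of_nonneg
    (fun τ hτ => by
      rw [Finset.mem_filter] at hτ ⊢
      exact ⟨hτ.1, by rw [hτ.2]; exact hc₀⟩)
    fun τ hτ _ => ha τ (Finset.mem_filter.1 hτ).1)

variable [DecidableEq ι] {l₀ : ℝ} {T : ℕ → Finset ι} {A B : ℕ → ℝ → ι → ℝ} {Bad : ℕ → ℝ → Finset ι}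
  {z η B₀ D V Λ : ℝ} {jstar : ℕ → ℕ}

/-- **MARGINAL EVENT DOMINATION ⇒ SLOT ODDS** with `x i = (B₀D/η)·(z⁻¹)^{K − j i}` (`ForestDom.sum_le` on the class
marginals) and the two-rate budget `S K = (B₀D/η)·V·(Λz⁻¹)^{K − j⋆(K) + 1}/(1 − Λz⁻¹)` (`T4HistoryPeeling.slotBudget_le`).
[folklore] -/
theorem MarginalEventDom.toSlotOdds (h : MarginalEventDom l₀ T A Bad z η B₀ D V Λ jstar) (hz : 0 < z) (hη : 0 < η)
    (hB₀ : 0 ≤ B₀) (hD : 0 ≤ D) (hV : 0 ≤ V) (hΛ : 0 ≤ Λ) (hr : Λ * z⁻¹ < 1) (hj : ∀ K, jstar K ≤ K)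
    (hA : ∀ K t, |t| ≤ l₀ → ∀ τ ∈ T K, 0 ≤ A K t τ) :
    SlotOdds l₀ T A Bad fun K => B₀ * D / η * V * ((Λ * z⁻¹) ^ (K - jstar K + 1) / (1 - Λ * z⁻¹)) where
  dom K t ht := by
    obtain ⟨n, m, hist, PendC, j, hsub, hcov, hold, hcount, hdom⟩ := h.dom K t ht
    have hC : 0 ≤ B₀ * D / η := div_nonneg (mul_nonneg hB₀ hD) hη.le
    have hσ : 0 ≤ z⁻¹ := inv_nonneg.2 hz.le
    refine ⟨n, fun i => (T K).filter fun τ => hist i τ ∈ PendC i, fun i => B₀ * D / η * (z⁻¹) ^ (K - j i),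
      fun i => mul_nonneg hC (pow_nonneg hσ _), ?_, hsub, fun i => Finset.filter_subset _ _, fun τ hτ => ?_,
      fun i => ?_⟩
    · exact slotBudget_le (fun i => B₀ * D / η * (z⁻¹) ^ (K - j i)) j hC hV hΛ hσ hr (hj K) hold hcount
        fun _ => le_rfl
    · obtain ⟨i, hi⟩ := hcov τ hτ
      exact ⟨i, Finset.mem_filter.2 ⟨hsub hτ, hi⟩⟩
    · have hoff : T K \ (T K).filter (fun τ => hist i τ ∈ PendC i) =
          (T K).filter (fun τ => hist i τ ∉ PendC i) := by rw [Finset.filter_not]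
      rw [sum_pending_eq_sum_marginals (T K) (hist i) (PendC i) (A K t), hoff]
      exact (hdom i).sum_le hz hη hB₀ (Finset.sum_nonneg fun τ hτ => hA K t ht τ (Finset.mem_filter.1 hτ).1)

/-- **THE ROW, MARGINAL RENEWAL READING, FROM MARGINAL EVENT DOMINATIONS TO THE OUTPUT SHAPE IN ONE CALL**: marginal
event dominations of both runs at a tilt `z > Λ > 0` with defect `η > 0`, root budget `B₀ ≥ 0`, terminal constant
`D ≥ 0`, R4 constant `V ≥ 0`, a positive fraction of old steps `c·K ≤ K − j⋆(K)`, `j⋆(K) ≤ K`, non-negative weights ⇒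
for some `K₀`, `T4WeightBudget.RelWeightBound` with weights `(B₀D/η)·V·(Λz⁻¹)^{K − j⋆(K) + 1}/(1 − Λz⁻¹)` from `K₀` on
(`exists_relWeightBound_of_slotOdds`; summability `T4HistoryPeeling.summable_twoRateBudget`).  No lower envelope of the
full sum, no (B)-shaped binder, no conditional of the consumer occurs. [folklore] -/
theorem exists_relWeightBound_of_marginalEventDom {c : ℝ} (hη : 0 < η) (hB₀ : 0 ≤ B₀) (hD : 0 ≤ D) (hV : 0 ≤ V)
    (hΛ : 0 < Λ) (hzΛ : Λ < z) (hc : 0 < c) (hj : ∀ K, jstar K ≤ K)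
    (hfrac : ∀ K : ℕ, c * K ≤ ((K - jstar K : ℕ) : ℝ))
    (hA : ∀ K t, |t| ≤ l₀ → ∀ τ ∈ T K, 0 ≤ A K t τ) (hB : ∀ K t, |t| ≤ l₀ → ∀ τ ∈ T K, 0 ≤ B K t τ)
    (hEA : MarginalEventDom l₀ T A Bad z η B₀ D V Λ jstar) (hEB : MarginalEventDom l₀ T B Bad z η B₀ D V Λ jstar) :
    ∃ K₀ : ℕ, RelWeightBound l₀ T A B (fun K t => if K₀ ≤ K then Bad K t else ∅)
      (Set.indicator {K | K₀ ≤ K} fun K =>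
        B₀ * D / η * V * ((Λ * z⁻¹) ^ (K - jstar K + 1) / (1 - Λ * z⁻¹))) := by
  have hz : 0 < z := hΛ.trans hzΛ
  have hC : 0 ≤ B₀ * D / η := div_nonneg (mul_nonneg hB₀ hD) hη.le
  have h0 : 0 < Λ * z⁻¹ := mul_pos hΛ (inv_pos.2 hz)
  have hr : Λ * z⁻¹ < 1 := by rw [← div_eq_mul_inv, div_lt_one hz]; exact hzΛ
  exact exists_relWeightBound_of_slotOdds (twoRateBudget_nonneg hC hV h0.le hr jstar)
    (summable_twoRateBudget hC hV h0 hr hc hfrac) hA hB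
    (hEA.toSlotOdds hz hη hB₀ hD hV hΛ.le hr hj hA) (hEB.toSlotOdds hz hη hB₀ hD hV hΛ.le hr hj hB)

end Marginal

/-! ## §4 A decided toy: the natural deletion price grows like `(3/2)^K` pointwise, the slot odds decay like `(3/4)^K` -/

section Toy

/-- The pending terms at step `K`: ONE structure pending, in context `c ≤ K`. [folklore] -/
def toyPend (K : ℕ) : Finset (Bool × ℕ) := (range (K + 1)).map (Function.Embedding.sectR true ℕ)

/-- The switched-off terms at step `K`: context `c ≤ K` alone. [folklore] -/
def toyOff (K : ℕ) : Finset (Bool × ℕ) := (range (K + 1)).map (Function.Embedding.sectR false ℕ)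

/-- The toy term family: pending and switched-off terms. [folklore] -/
def toyT (K : ℕ) : Finset (Bool × ℕ) := toyPend K ∪ toyOff K

/-- The toy weights (independent of the source `t`): context `c` alone weighs `4^{−c}`; with the pending structure it
weighs `σ^K · 2^{−c}`, `σ = 3/4` — inserting the structure into context `c` multiplies the weight by `σ^K · 2^{c}`, NOT
uniformly in the context (the toy's stand-in for what a deleted structure changes in its context). [folklore] -/
noncomputable def toyA (K : ℕ) (_t : ℝ) (τ : Bool × ℕ) : ℝ :=
  if τ.1 = true then (3 / 4 : ℝ) ^ K * (1 / 2 : ℝ) ^ τ.2 else (1 / 4 : ℝ) ^ τ.2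

/-- The toy bad class: the pending terms. [folklore] -/
def toyBad (K : ℕ) (_t : ℝ) : Finset (Bool × ℕ) := toyPend K

/-- Pending and switched-off terms are disjoint. [folklore] -/
theorem toy_disjoint (K : ℕ) : Disjoint (toyPend K) (toyOff K) := by
  refine Finset.disjoint_left.2 fun τ h1 h2 => ?_
  simp only [toyPend, toyOff, Finset.mem_map, Function.Embedding.sectR_apply] at h1 h2
  obtain ⟨c, -, rfl⟩ := h1
  obtain ⟨c', -, h⟩ := h2
  simp at h

/-- Switching off: `toyT K ∖ toyPend K = toyOff K`. [folklore] -/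
theorem toyT_sdiff (K : ℕ) : toyT K \ toyPend K = toyOff K := Finset.union_sdiff_cancel_left (toy_disjoint K)

/-- The pending mass at step `K`: `σ^K · Σ_{c ≤ K} 2^{−c} ≤ 2σ^K`. [folklore] -/
theorem toy_sum_pend_le (K : ℕ) (t : ℝ) : ∑ τ ∈ toyPend K, toyA K t τ ≤ 2 * (3 / 4 : ℝ) ^ K := by
  have hgeom : ∑ c ∈ range (K + 1), (1 / 2 : ℝ) ^ c ≤ 2 := by
    rw [Finset.range_eq_Ico]
    have h := geom_sum_Ico_le_of_lt_one (m := 0) (n := K + 1) (x := (1 / 2 : ℝ)) (by norm_num) (by norm_num)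
    have h2 : (1 / 2 : ℝ) ^ 0 / (1 - 1 / 2) = 2 := by norm_num
    linarith
  have hσ : 0 ≤ (3 / 4 : ℝ) ^ K := pow_nonneg (by norm_num) K
  calc ∑ τ ∈ toyPend K, toyA K t τ = ∑ c ∈ range (K + 1), (3 / 4 : ℝ) ^ K * (1 / 2 : ℝ) ^ c := by
        rw [toyPend, Finset.sum_map]
        exact Finset.sum_congr rfl fun c _ => by simp [toyA]
    _ = (3 / 4 : ℝ) ^ K * ∑ c ∈ range (K + 1), (1 / 2 : ℝ) ^ c := by rw [Finset.mul_sum]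
    _ ≤ (3 / 4 : ℝ) ^ K * 2 := mul_le_mul_of_nonneg_left hgeom hσ
    _ = 2 * (3 / 4 : ℝ) ^ K := by ring

/-- The switched-off mass at step `K` is at least `1` (the context `c = 0`). [folklore] -/
theorem toy_one_le_sum_off (K : ℕ) (t : ℝ) : 1 ≤ ∑ τ ∈ toyOff K, toyA K t τ := by
  have h : ∑ τ ∈ toyOff K, toyA K t τ = ∑ c ∈ range (K + 1), (1 / 4 : ℝ) ^ c := by
    rw [toyOff, Finset.sum_map]
    exact Finset.sum_congr rfl fun c _ => by simp [toyA]
  rw [h]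
  calc (1 : ℝ) = (1 / 4 : ℝ) ^ 0 := by norm_num
    _ ≤ ∑ c ∈ range (K + 1), (1 / 4 : ℝ) ^ c :=
        Finset.single_le_sum (f := fun c => (1 / 4 : ℝ) ^ c) (fun c _ => pow_nonneg (by norm_num) c)
          (Finset.mem_range.2 (Nat.succ_pos K))

/-- The toy weights are non-negative. [folklore] -/
theorem toyA_nonneg (K : ℕ) (t : ℝ) (τ : Bool × ℕ) : 0 ≤ toyA K t τ := by
  unfold toyA
  split_ifs
  · exact mul_nonneg (pow_nonneg (by norm_num) _) (pow_nonneg (by norm_num) _)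
  · exact pow_nonneg (by norm_num) _

/-- **THE TOY INHABITS `SlotOdds`** with ONE slot (`P := toyPend K`) and odds `2σ^K`: the AVERAGED clause holds with a
summable budget although the pointwise deletion price is unbounded (`toy_pointwise_ge`). [folklore] -/
theorem toy_slotOdds (l₀ : ℝ) : SlotOdds l₀ toyT toyA toyBad fun K => 2 * (3 / 4 : ℝ) ^ K where
  dom K t _ := by
    refine ⟨1, fun _ => toyPend K, fun _ => 2 * (3 / 4 : ℝ) ^ K,
      fun _ => mul_nonneg (by norm_num) (pow_nonneg (by norm_num) K), by simp, Finset.subset_union_left,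
      fun _ => Finset.subset_union_left, fun τ hτ => ⟨0, hτ⟩, fun _ => ?_⟩
    rw [toyT_sdiff]
    calc ∑ τ ∈ toyPend K, toyA K t τ ≤ 2 * (3 / 4 : ℝ) ^ K := toy_sum_pend_le K t
      _ = 2 * (3 / 4 : ℝ) ^ K * 1 := (mul_one _).symm
      _ ≤ 2 * (3 / 4 : ℝ) ^ K * ∑ τ ∈ toyOff K, toyA K t τ :=
          mul_le_mul_of_nonneg_left (toy_one_le_sum_off K t) (mul_nonneg (by norm_num) (pow_nonneg (by norm_num) K))

/-- **… HENCE THE OUTPUT SHAPE** for the toy (both runs = the toy run): for some `K₀`, `RelWeightBound` with weights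
`2σ^K` from `K₀` on. [folklore] -/
theorem toy_relWeightBound (l₀ : ℝ) : ∃ K₀ : ℕ, RelWeightBound l₀ toyT toyA toyA
    (fun K t => if K₀ ≤ K then toyBad K t else ∅) (Set.indicator {K | K₀ ≤ K} fun K => 2 * (3 / 4 : ℝ) ^ K) :=
  exists_relWeightBound_of_slotOdds (fun K => mul_nonneg (by norm_num) (pow_nonneg (by norm_num) K))
    ((summable_geometric_of_lt_one (by norm_num) (by norm_num)).mul_left 2) (fun K t _ τ _ => toyA_nonneg K t τ)
    (fun K t _ τ _ => toyA_nonneg K t τ) (toy_slotOdds l₀) (toy_slotOdds l₀)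

/-- **THE POINTWISE PRICE OF THE NATURAL DELETION IS `≥ (3/2)^K`**: any context-free `y` with
`A (true, c) ≤ y · A (false, c)` for all contexts `c ≤ K` satisfies `(3/2)^K ≤ y` (test the context `c = K`).
[folklore] -/
theorem toy_pointwise_ge (K : ℕ) (t : ℝ) {y : ℝ} (h : ∀ c ≤ K, toyA K t (true, c) ≤ y * toyA K t (false, c)) :
    (3 / 2 : ℝ) ^ K ≤ y := by
  have hK := h K le_rfl
  simp only [toyA, if_true] at hK
  have hpos : 0 < (1 / 4 : ℝ) ^ K := pow_pos (by norm_num) K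
  have hprod : (3 / 2 : ℝ) ^ K * (1 / 4 : ℝ) ^ K = (3 / 4 : ℝ) ^ K * (1 / 2 : ℝ) ^ K := by
    rw [← mul_pow, ← mul_pow]; norm_num
  have h2 : (3 / 2 : ℝ) ^ K * (1 / 4 : ℝ) ^ K ≤ y * (1 / 4 : ℝ) ^ K := by
    rw [hprod]
    simpa using hK
  exact le_of_mul_le_mul_right h2 hpos

/-- **NO `K`-UNIFORM CONTEXT-FREE DELETION PRICE EXISTS** in the toy (`(3/2)^K` is unbounded), although the slot odds
are summable (`toy_slotOdds`): what the slot consumes is the AVERAGE over contexts weighted by their own mass, not the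
supremum. [folklore] -/
theorem toy_no_uniform_price (t : ℝ) :
    ¬ ∃ y : ℝ, ∀ K, ∀ c ≤ K, toyA K t (true, c) ≤ y * toyA K t (false, c) := by
  rintro ⟨y, hy⟩
  obtain ⟨K, hK⟩ := pow_unbounded_of_one_lt y (by norm_num : (1 : ℝ) < 3 / 2)
  exact absurd (toy_pointwise_ge K t (hy K)) (not_le.2 hK)

/-- Non-vacuity: the toy bad class has positive weight at every step. [folklore] -/
theorem toy_bad_pos (K : ℕ) (t : ℝ) : 0 < ∑ τ ∈ toyBad K t, toyA K t τ := by
  have h : ∑ τ ∈ toyBad K t, toyA K t τ = ∑ c ∈ range (K + 1), (3 / 4 : ℝ) ^ K * (1 / 2 : ℝ) ^ c := by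
    rw [toyBad, toyPend, Finset.sum_map]
    exact Finset.sum_congr rfl fun c _ => by simp [toyA]
  rw [h]
  exact Finset.sum_pos (fun c _ => mul_pos (pow_pos (by norm_num) K) (pow_pos (by norm_num) c))
    ⟨0, Finset.mem_range.2 (Nat.succ_pos K)⟩

end Toy

end Literature.MathematicalPhysics.QuantumFieldTheory.Balaban1983to89.T4MarginalRenewal
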